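import Summits.QuantumFields.BalabanUV.T4Continuum.Support.FirstOrderAdjointModel

/-!
# T⁴ programme, spine node NE2 (U1a), sub-row Δ1 — THE 𝒢-SANDWICHED KING LAW OF THE VECTOR LAPLACIAN:
# `‖𝒢^{(RN)}·(Δ′J_R − J_RΔ)·𝒢^{(N)}‖ ≤ 4d²(R+1)·Cst²/N` (the (H-cons) currency of the graded well's leaf (GW-E), Laplacian piece)

NE2 formalisation swarm `b2b-balaban-t4-ne2-formalise-*`, LEAF PROVER 06 (gen 8), item «(E-Δ)» (journal 2026-08-21, this seat's LANDED line
of `GradedWellTowerAssembly` p246271).  Context: the owner's torus transfer (`GradedWellTorusTransfer.hinjK_GW_of_torus`, R49) runs King's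
injected law of the graded-well propagators off the faithful unit torus operator `Δ_a` and ONE two-level leaf (GW-E) on the level-free-rank
difference `E_k = Δ_a^{(k)} − regionGW_k`.  The resolvent identity
`X′⁻¹J − JX⁻¹ = (1 + X′⁻¹E′)·(Y′⁻¹J − JY⁻¹ + Y′⁻¹(E′J − JE)Y⁻¹)·(1 + EX⁻¹)` (companion file `GradedWellConsistencyTransfer`) shows that
(GW-E) is needed only SANDWICHED BY THE FREE TORUS PROPAGATORS `𝒢 = Δ_a⁻¹` — the (H-cons) currency of tiers A/B — and since
`regionGW = Σ_ν∇_νᴴ∇_ν + a·Q_GWᴴQ_GW − B·K⁻¹·Bᴴ` (`GradedWellData.localGW_eq` + the resolvent split), the pieces of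
`𝒢′(E′J − JE)𝒢` are: the injected law of `Δ_a` itself (a THEOREM, `KingPairingPlantedLaw.injected_le_lev`), the graded-mass commutator,
the GW gauge sandwich, and THE VECTOR LAPLACIAN's sandwiched commutator — this file:

 * §1 per direction, the EXACT decomposition **`lapDir_comm_eq`**:
   `∇′ᴴ∇′J − J∇ᴴ∇ = ∇′ᴴ·(R·F − 1)J·∇ + (∇′ᴴJ − J∇ᴴ)·∇` (from `BlockPairingGeometry.fdiff_mul_JK`: `∇′J = R·F·J∇`, `F` = far-face
   indicator), both middle factors BLOCK-MEAN FREE: `Π·(R·F − 1)J = 0` (`BlockPairingFaces.Pi_mul_face_defect_mul_JK`),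
   `Π·(∇′ᴴJ − J∇ᴴ) = 0` (`FirstOrderAdjointModel.Pi_mul_adjoint_defect`);
 * §2 the two smoothing bounds: **`opNorm_calG_fdiffH_one_sub_Pi_le`** `‖𝒢′∇′_μᴴ(1 − Π)‖ = ‖(1 − Π)∇′_μ𝒢′‖ ≤ 2dCst/N` (block Poincaré
   `BalabanBlockPoincare.opNorm_one_sub_Pi_mul_le` on the HESSIAN bound of (1.89), `B5Prop11Plancherel.opNorm_fdiff_fdiff_calG_le`) and
   `‖𝒢′(1 − Π)‖ ≤ 2dCst/N` (`KingPairingPlantedLaw.opNorm_calG_mul_one_sub_Pi_le`); the two bounded factors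
   `‖(R·F − 1)J∇𝒢‖ ≤ (R+1)Cst`, `‖(∇′ᴴJ − J∇ᴴ)∇𝒢‖ ≤ (R+1)Cst` ((1.89) first and second order);
 * §3 **`opNorm_calG_lapDir_comm_calG_le`** `‖𝒢′(∇′_μᴴ∇′_μJ − J∇_μᴴ∇_μ)𝒢‖ ≤ 4d(R+1)Cst²/N` and, summed over directions,
   **`opNorm_calG_Lap_comm_calG_le`** `‖𝒢^{(RN)}(Δ′J_R − J_RΔ)𝒢^{(N)}‖ ≤ 4d²(R+1)Cst²/N`;
 * §4 the tower form **`lap_consistent_le_lev`**: `‖𝒢^{(k+1)}(Δ_{k+1}J_k − J_kΔ_k)𝒢^{(k)}‖ ≤ 4d²(L+1)Cst²·L^{−k}`, also spelled with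
   `B5Action121.LapV` (`lapV_consistent_le_lev`) — the shape consumed by the graded well's (H-cons) split.

Remark (why the sandwich is essential): `J_RᴴΔ′J_R = R·Δ` (the Dirichlet energy of a piecewise-constant extension is `R` times the coarse
energy), so `Δ′J_R − J_RΔ` is NOT small on rough fields and not even block-mean free; smallness comes only from the smoothing propagators.

HONEST FRAMING (T4-DAG p. 1).  `U = 1`, finite torus, free vector Laplacian and B5's free propagator `𝒢`; linear algebra over landed
modules + (1.89) up to second order; statements / constants OURS ([folklore]); NOT a statement about Bałaban's multi-region kernels; NE2 (U1a)
NOT proved; spine PROVED 0/9 unchanged; NOT [B9] (3.16)/(3.23)–(3.27)/(3.42) as printed; NOT infinite volume / mass gap / Clay.  HONEST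
DEPENDENCY: continuum YM on T⁴ ⇐ BetaPertH ∧ nine spine estimates (0/9 proved); BetaPertH ⇐ (D1) ∧ (D4) ∧ CAP+tail; G-an2-4 gates asym, D1
and NE2/3/4.  No `sorry`.
-/

noncomputable section

open scoped BigOperators ComplexConjugate Matrix Matrix.Norms.L2Operator

namespace Summit.QuantumFields.BalabanUV.T4Continuum.KingLaplacianConsistency

open Literature.MathematicalPhysics.QuantumFieldTheory.Balaban1983to89.B5Prop11Plancherel
open Literature.MathematicalPhysics.QuantumFieldTheory.Balaban1983to89.B5Prop11Lower (Lap)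
open Literature.MathematicalPhysics.QuantumFieldTheory.Balaban1983to89.B5Action121 (LapV)
open Literature.MathematicalPhysics.QuantumFieldTheory.Balaban1983to89.B5G183RateUnitTower (lev lev_neZero)
open Summit.QuantumFields.BalabanUV.T4Continuum
open Summit.QuantumFields.BalabanUV.T4Continuum.BalabanAveragedTowerUnit (idx calGlev one_le_lev' cast_lev')
open Summit.QuantumFields.BalabanUV.T4Continuum.BalabanBlockPoincare (Pi opNorm_one_sub_Pi_mul_le opNorm_shiftM_sub_one_mul_le)
open Summit.QuantumFields.BalabanUV.T4Continuum.KingPairingPlantedLaw (JK JpcT JK_mul_conjTranspose Pi_conjTranspose opNorm_JK_le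
  opNorm_calG_mul_one_sub_Pi_le calDalev calDalev_inv)
open Summit.QuantumFields.BalabanUV.T4Continuum.BlockPairingGeometry (faceF fdiff_mul_JK opNorm_shiftM_le)
open Summit.QuantumFields.BalabanUV.T4Continuum.BlockPairingFaces (Pi_mul_face_defect_mul_JK opNorm_faceF_le opNorm_face_defect_le)
open Summit.QuantumFields.BalabanUV.T4Continuum.FirstOrderAdjointModel (conjTranspose_fdiff_eq conjTranspose_fdiff_mul_JK
  Pi_mul_adjoint_defect)

variable {d : ℕ}

/-- `‖A‖ ≤ 1`, `‖B‖ ≤ 1` ⟹ `‖AB‖ ≤ 1`. [folklore] -/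
theorem opNorm_mul_le_one {p q r : Type*} [Fintype p] [DecidableEq p] [Fintype q] [DecidableEq q] [Fintype r] [DecidableEq r]
    {A : Matrix p q ℂ} {B : Matrix q r ℂ} (hA : ‖A‖ ≤ 1) (hB : ‖B‖ ≤ 1) : ‖A * B‖ ≤ 1 :=
  calc ‖A * B‖ ≤ ‖A‖ * ‖B‖ := Matrix.l2_opNorm_mul _ _
    _ ≤ 1 * 1 := mul_le_mul hA hB (norm_nonneg _) zero_le_one
    _ = 1 := one_mul 1

/-! ## §1 The exact decomposition per direction -/

section TwoLevel

variable (N R : ℕ) [NeZero N] [NeZero R] (M : Fin d → ℕ) [hM : ∀ μ, NeZero (M μ)] (a : ℝ) (ha : 0 < a)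

/-- shorthand: the coarse difference `∇_μ = N(S_μ − 1)` on level-`N` 1-forms. [folklore] -/
abbrev gradC (μ : Fin d) : Matrix (Tor (fine N M) × Fin d) (Tor (fine N M) × Fin d) ℂ := fdiff (fine N M) ((N : ℕ) : ℂ) μ

/-- shorthand: the fine difference `∇′_μ = RN(S′_μ − 1)` on level-`RN` 1-forms. [folklore] -/
abbrev gradF (μ : Fin d) : Matrix (Tor (fine (R * N) M) × Fin d) (Tor (fine (R * N) M) × Fin d) ℂ :=
  fdiff (fine (R * N) M) (((R * N : ℕ)) : ℂ) μ

/-- **THE DECOMPOSITION**: `∇′ᴴ∇′J − J∇ᴴ∇ = ∇′ᴴ·((R·F − 1)J)·∇ + (∇′ᴴJ − J∇ᴴ)·∇`. [folklore] -/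
theorem lapDir_comm_eq (hN : 1 ≤ N) (μ : Fin d) :
    (gradF N R M μ)ᴴ * gradF N R M μ * JK N R M - JK N R M * ((gradC N M μ)ᴴ * gradC N M μ)
      = (gradF N R M μ)ᴴ * ((((R : ℂ)) • faceF N R M μ - 1) * JK N R M) * gradC N M μ
        + ((gradF N R M μ)ᴴ * JK N R M - JK N R M * (gradC N M μ)ᴴ) * gradC N M μ := by
  have h1 : (gradF N R M μ)ᴴ * gradF N R M μ * JK N R M
      = ((R : ℂ)) • ((gradF N R M μ)ᴴ * faceF N R M μ * JK N R M * gradC N M μ) := by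
    rw [Matrix.mul_assoc, gradF, fdiff_mul_JK N R M hN μ, Matrix.mul_smul]
    simp only [Matrix.mul_assoc]
  rw [h1]
  simp only [Matrix.sub_mul, Matrix.mul_sub, Matrix.smul_mul, Matrix.mul_smul, Matrix.one_mul, Matrix.mul_assoc]
  abel

/-- the face-defect factor is block-mean free: `(R·F − 1)J = (1 − Π)·(R·F − 1)J`. [folklore] -/
theorem face_defect_eq_one_sub_Pi_mul (hd : 1 ≤ d) (μ : Fin d) :
    (((R : ℂ)) • faceF N R M μ - 1) * JK N R M = (1 - Pi N R M) * ((((R : ℂ)) • faceF N R M μ - 1) * JK N R M) := by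
  rw [Matrix.sub_mul (1 : Matrix _ _ ℂ) (Pi N R M), Matrix.one_mul, ← Matrix.mul_assoc, Pi_mul_face_defect_mul_JK N R M hd μ,
    sub_zero]

/-- the adjoint-defect factor is block-mean free: `∇′ᴴJ − J∇ᴴ = (1 − Π)·(∇′ᴴJ − J∇ᴴ)`. [folklore] -/
theorem adjoint_defect_eq_one_sub_Pi_mul (hd : 1 ≤ d) (hN : 1 ≤ N) (μ : Fin d) :
    (gradF N R M μ)ᴴ * JK N R M - JK N R M * (gradC N M μ)ᴴ
      = (1 - Pi N R M) * ((gradF N R M μ)ᴴ * JK N R M - JK N R M * (gradC N M μ)ᴴ) := by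
  rw [Matrix.sub_mul (1 : Matrix _ _ ℂ), Matrix.one_mul, Pi_mul_adjoint_defect N R M hd hN μ, sub_zero]

/-! ## §2 The two smoothing bounds and the two bounded factors -/

/-- **block Poincaré on the Hessian**: `‖(1 − Π)·∇′_μ𝒢′‖ ≤ 2dCst/N` ((1.89) second order: `‖∇′_ν∇′_μ𝒢′‖ ≤ Cst`). [cite:
Balaban1984PropagatorsI, Prop. 1.1 (1.89) p.33] [folklore] -/
theorem opNorm_one_sub_Pi_fdiff_calG_le (hN : 1 ≤ N) (hRN : 1 ≤ R * N) (μ : Fin d) :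
    ‖(1 - Pi N R M) * (gradF N R M μ * calG (R * N) hRN M a ha)‖ ≤ 2 * d * Cst d a / N := by
  have hNpos : (0 : ℝ) < N := by exact_mod_cast hN
  have hRpos : (0 : ℝ) < R := by exact_mod_cast Nat.pos_of_ne_zero (NeZero.ne R)
  have hc : (((R * N : ℕ) : ℂ)) ≠ 0 := by exact_mod_cast (Nat.pos_iff_ne_zero.mp hRN)
  have hcn : ‖(((R * N : ℕ) : ℂ))‖ = (R : ℝ) * N := by rw [Complex.norm_natCast]; push_cast; ring
  have hX : ∀ ν, ‖(shiftM (fine (R * N) M) ν - 1) * (gradF N R M μ * calG (R * N) hRN M a ha)‖ ≤ Cst d a / ((R : ℝ) * N) := by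
    intro ν
    have h2 : ‖fdiff (fine (R * N) M) (((R * N : ℕ)) : ℂ) ν * (gradF N R M μ * calG (R * N) hRN M a ha)‖ ≤ Cst d a := by
      rw [← Matrix.mul_assoc]; exact opNorm_fdiff_fdiff_calG_le (R * N) hRN M a ha ν μ
    have h := opNorm_shiftM_sub_one_mul_le (gradF N R M μ * calG (R * N) hRN M a ha) hc ν h2
    rwa [hcn] at h
  have hδ : 0 ≤ Cst d a / ((R : ℝ) * N) := by have := Cst_nonneg d a; positivity
  refine (opNorm_one_sub_Pi_mul_le N R M _ hδ hX).trans (le_of_eq ?_)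
  field_simp

/-- **`‖𝒢′·∇′_μᴴ·(1 − Π)‖ ≤ 2dCst/N`** (the adjoint of the previous bound: `Π`, `𝒢′` Hermitian). [cite: Balaban1984PropagatorsI, Prop. 1.1
(1.89) p.33] [folklore] -/
theorem opNorm_calG_fdiffH_one_sub_Pi_le (hN : 1 ≤ N) (hRN : 1 ≤ R * N) (μ : Fin d) :
    ‖calG (R * N) hRN M a ha * (gradF N R M μ)ᴴ * (1 - Pi N R M)‖ ≤ 2 * d * Cst d a / N := by
  have e : calG (R * N) hRN M a ha * (gradF N R M μ)ᴴ * (1 - Pi N R M)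
      = ((1 - Pi N R M) * (gradF N R M μ * calG (R * N) hRN M a ha))ᴴ := by
    rw [Matrix.conjTranspose_mul, Matrix.conjTranspose_mul, Matrix.conjTranspose_sub, Matrix.conjTranspose_one, Pi_conjTranspose,
      (calG_isHermitian (R * N) hRN M a ha).eq, Matrix.mul_assoc]
  rw [e, Matrix.l2_opNorm_conjTranspose]
  exact opNorm_one_sub_Pi_fdiff_calG_le N R M a ha hN hRN μ

/-- `‖𝒢′·(1 − Π)‖ ≤ 2dCst/N` (`KingPairingPlantedLaw.opNorm_calG_mul_one_sub_Pi_le`, `Π = J_RJ_Rᴴ`). [folklore] -/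
theorem opNorm_calG_one_sub_Pi_le (hN : 1 ≤ N) (hRN : 1 ≤ R * N) :
    ‖calG (R * N) hRN M a ha * (1 - Pi N R M)‖ ≤ 2 * d * Cst d a / N := by
  rw [← JK_mul_conjTranspose]; exact opNorm_calG_mul_one_sub_Pi_le N R M a ha hN hRN

/-- `‖∇_μᴴ∇_μ𝒢‖ ≤ Cst` (`∇ᴴ = −Sᴴ∇` and (1.89) second order). [cite: Balaban1984PropagatorsI, Prop. 1.1 (1.89) p.33] [folklore] -/
theorem opNorm_fdiffH_fdiff_calG_le (n : ℕ) [NeZero n] (hn : 1 ≤ n) (μ : Fin d) :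
    ‖(fdiff (fine n M) ((n : ℕ) : ℂ) μ)ᴴ * fdiff (fine n M) ((n : ℕ) : ℂ) μ * calG n hn M a ha‖ ≤ Cst d a := by
  rw [conjTranspose_fdiff_eq n M μ, Matrix.neg_mul, Matrix.neg_mul, norm_neg, Matrix.mul_assoc, Matrix.mul_assoc]
  have hS : ‖(shiftM (fine n M) μ)ᴴ‖ ≤ 1 := by rw [Matrix.l2_opNorm_conjTranspose]; exact opNorm_shiftM_le _ μ
  calc ‖(shiftM (fine n M) μ)ᴴ * (fdiff (fine n M) ((n : ℕ) : ℂ) μ * (fdiff (fine n M) ((n : ℕ) : ℂ) μ * calG n hn M a ha))‖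
      ≤ ‖(shiftM (fine n M) μ)ᴴ‖ * ‖fdiff (fine n M) ((n : ℕ) : ℂ) μ * (fdiff (fine n M) ((n : ℕ) : ℂ) μ * calG n hn M a ha)‖ :=
        Matrix.l2_opNorm_mul _ _
    _ ≤ 1 * Cst d a := by
        refine mul_le_mul hS ?_ (norm_nonneg _) zero_le_one
        rw [← Matrix.mul_assoc]; exact opNorm_fdiff_fdiff_calG_le n hn M a ha μ μ
    _ = Cst d a := one_mul _

/-- the face-defect factor is bounded: `‖(R·F − 1)J·∇𝒢‖ ≤ (R+1)·Cst`. [cite: Balaban1984PropagatorsI, Prop. 1.1 (1.89) p.33] [folklore] -/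
theorem opNorm_face_defect_fdiff_calG_le (hN : 1 ≤ N) (μ : Fin d) :
    ‖(((R : ℂ)) • faceF N R M μ - 1) * JK N R M * (gradC N M μ * calG N hN M a ha)‖ ≤ ((R : ℝ) + 1) * Cst d a := by
  have h0 : (0 : ℝ) ≤ (R : ℝ) + 1 := by positivity
  calc ‖(((R : ℂ)) • faceF N R M μ - 1) * JK N R M * (gradC N M μ * calG N hN M a ha)‖
      ≤ ‖(((R : ℂ)) • faceF N R M μ - 1) * JK N R M‖ * ‖gradC N M μ * calG N hN M a ha‖ := Matrix.l2_opNorm_mul _ _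
    _ ≤ ‖((R : ℂ)) • faceF N R M μ - 1‖ * ‖JK N R M‖ * ‖gradC N M μ * calG N hN M a ha‖ :=
        mul_le_mul_of_nonneg_right (Matrix.l2_opNorm_mul _ _) (norm_nonneg _)
    _ ≤ ((R : ℝ) + 1) * 1 * Cst d a := by
        gcongr
        · exact opNorm_face_defect_le N R M μ
        · exact opNorm_JK_le N R M
        · exact opNorm_fdiff_calG_le N hN M a ha μ
    _ = ((R : ℝ) + 1) * Cst d a := by ring

/-- the adjoint-defect factor is bounded: `‖(∇′ᴴJ − J∇ᴴ)·∇𝒢‖ ≤ (R+1)·Cst` (`∇′ᴴJ = R·S′ᴴFJS∇ᴴ` and `‖∇ᴴ∇𝒢‖ ≤ Cst`). [cite: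
Balaban1984PropagatorsI, Prop. 1.1 (1.89) p.33] [folklore] -/
theorem opNorm_adjoint_defect_fdiff_calG_le (hN : 1 ≤ N) (μ : Fin d) :
    ‖((gradF N R M μ)ᴴ * JK N R M - JK N R M * (gradC N M μ)ᴴ) * (gradC N M μ * calG N hN M a ha)‖ ≤ ((R : ℝ) + 1) * Cst d a := by
  have hH := opNorm_fdiffH_fdiff_calG_le M a ha N hN μ
  have hS' : ‖(shiftM (fine (R * N) M) μ)ᴴ‖ ≤ 1 := by rw [Matrix.l2_opNorm_conjTranspose]; exact opNorm_shiftM_le _ μ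
  have hS : ‖shiftM (fine N M) μ‖ ≤ 1 := opNorm_shiftM_le _ μ
  have hCst := Cst_nonneg d a
  -- first piece: `∇′ᴴJ∇𝒢 = R·S′ᴴFJS·(∇ᴴ∇𝒢)`
  have hT : ‖(shiftM (fine (R * N) M) μ)ᴴ * faceF N R M μ * JK N R M * shiftM (fine N M) μ‖ ≤ 1 :=
    opNorm_mul_le_one (opNorm_mul_le_one (opNorm_mul_le_one hS' (opNorm_faceF_le N R M μ)) (opNorm_JK_le N R M)) hS
  have h1 : ‖(gradF N R M μ)ᴴ * JK N R M * (gradC N M μ * calG N hN M a ha)‖ ≤ (R : ℝ) * Cst d a := by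
    have e : (gradF N R M μ)ᴴ * JK N R M * (gradC N M μ * calG N hN M a ha)
        = ((R : ℂ)) • ((shiftM (fine (R * N) M) μ)ᴴ * faceF N R M μ * JK N R M * shiftM (fine N M) μ
            * ((gradC N M μ)ᴴ * gradC N M μ * calG N hN M a ha)) := by
      have hc := conjTranspose_fdiff_mul_JK N R M hN μ
      dsimp only [gradF, gradC]
      rw [hc, Matrix.smul_mul]
      simp only [Matrix.mul_assoc]
    rw [e, norm_smul, Complex.norm_natCast]
    refine mul_le_mul_of_nonneg_left ?_ (Nat.cast_nonneg R)
    calc ‖(shiftM (fine (R * N) M) μ)ᴴ * faceF N R M μ * JK N R M * shiftM (fine N M) μ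
            * ((gradC N M μ)ᴴ * gradC N M μ * calG N hN M a ha)‖
        ≤ ‖(shiftM (fine (R * N) M) μ)ᴴ * faceF N R M μ * JK N R M * shiftM (fine N M) μ‖
            * ‖(gradC N M μ)ᴴ * gradC N M μ * calG N hN M a ha‖ := Matrix.l2_opNorm_mul _ _
      _ ≤ 1 * Cst d a := mul_le_mul hT hH (norm_nonneg _) zero_le_one
      _ = Cst d a := one_mul _
  -- second piece: `J∇ᴴ∇𝒢`
  have h2 : ‖JK N R M * (gradC N M μ)ᴴ * (gradC N M μ * calG N hN M a ha)‖ ≤ Cst d a := by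
    rw [Matrix.mul_assoc]
    calc ‖JK N R M * ((gradC N M μ)ᴴ * (gradC N M μ * calG N hN M a ha))‖
        ≤ ‖JK N R M‖ * ‖(gradC N M μ)ᴴ * (gradC N M μ * calG N hN M a ha)‖ := Matrix.l2_opNorm_mul _ _
      _ ≤ 1 * Cst d a := by
          refine mul_le_mul (opNorm_JK_le N R M) ?_ (norm_nonneg _) zero_le_one
          rw [← Matrix.mul_assoc]; exact hH
      _ = Cst d a := one_mul _
  rw [Matrix.sub_mul]
  calc _ ≤ ‖(gradF N R M μ)ᴴ * JK N R M * (gradC N M μ * calG N hN M a ha)‖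
        + ‖JK N R M * (gradC N M μ)ᴴ * (gradC N M μ * calG N hN M a ha)‖ := norm_sub_le _ _
    _ ≤ (R : ℝ) * Cst d a + Cst d a := add_le_add h1 h2
    _ = ((R : ℝ) + 1) * Cst d a := by ring

/-! ## §3 The sandwiched commutator: one direction, and the Laplacian -/

/-- **ONE DIRECTION**: `‖𝒢′·(∇′_μᴴ∇′_μJ − J∇_μᴴ∇_μ)·𝒢‖ ≤ 4d(R+1)·Cst²/N`. [cite: Balaban1984PropagatorsI, Prop. 1.1 (1.89) p.33; King1986,
(2.10) p.653] [folklore] -/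
theorem opNorm_calG_lapDir_comm_calG_le (hd : 1 ≤ d) (hN : 1 ≤ N) (hRN : 1 ≤ R * N) (μ : Fin d) :
    ‖calG (R * N) hRN M a ha * ((gradF N R M μ)ᴴ * gradF N R M μ * JK N R M - JK N R M * ((gradC N M μ)ᴴ * gradC N M μ))
        * calG N hN M a ha‖ ≤ 4 * d * ((R : ℝ) + 1) * Cst d a ^ 2 / N := by
  have hNpos : (0 : ℝ) < N := by exact_mod_cast hN
  have hCst := Cst_nonneg d a
  have hsm : 0 ≤ 2 * d * Cst d a / N := by positivity
  have hR1 : (0 : ℝ) ≤ ((R : ℝ) + 1) * Cst d a := by positivity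
  rw [lapDir_comm_eq N R M hN μ, Matrix.mul_add, Matrix.add_mul]
  -- piece A: `𝒢′∇′ᴴ(1 − Π)·[(R·F − 1)J∇𝒢]`
  have hA : ‖calG (R * N) hRN M a ha * ((gradF N R M μ)ᴴ * ((((R : ℂ)) • faceF N R M μ - 1) * JK N R M) * gradC N M μ)
      * calG N hN M a ha‖ ≤ 2 * d * Cst d a / N * (((R : ℝ) + 1) * Cst d a) := by
    have e : calG (R * N) hRN M a ha * ((gradF N R M μ)ᴴ * ((((R : ℂ)) • faceF N R M μ - 1) * JK N R M) * gradC N M μ)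
          * calG N hN M a ha
        = (calG (R * N) hRN M a ha * (gradF N R M μ)ᴴ * (1 - Pi N R M))
            * ((((R : ℂ)) • faceF N R M μ - 1) * JK N R M * (gradC N M μ * calG N hN M a ha)) := by
      conv_lhs => rw [face_defect_eq_one_sub_Pi_mul N R M hd μ]
      simp only [Matrix.mul_assoc]
    rw [e]
    exact (Matrix.l2_opNorm_mul _ _).trans (mul_le_mul (opNorm_calG_fdiffH_one_sub_Pi_le N R M a ha hN hRN μ)
      (opNorm_face_defect_fdiff_calG_le N R M a ha hN μ) (norm_nonneg _) hsm)
  -- piece B: `𝒢′(1 − Π)·[(∇′ᴴJ − J∇ᴴ)∇𝒢]`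
  have hB : ‖calG (R * N) hRN M a ha * (((gradF N R M μ)ᴴ * JK N R M - JK N R M * (gradC N M μ)ᴴ) * gradC N M μ)
      * calG N hN M a ha‖ ≤ 2 * d * Cst d a / N * (((R : ℝ) + 1) * Cst d a) := by
    have e : calG (R * N) hRN M a ha * (((gradF N R M μ)ᴴ * JK N R M - JK N R M * (gradC N M μ)ᴴ) * gradC N M μ)
          * calG N hN M a ha
        = (calG (R * N) hRN M a ha * (1 - Pi N R M))
            * (((gradF N R M μ)ᴴ * JK N R M - JK N R M * (gradC N M μ)ᴴ) * (gradC N M μ * calG N hN M a ha)) := by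
      conv_lhs => rw [adjoint_defect_eq_one_sub_Pi_mul N R M hd hN μ]
      simp only [Matrix.mul_assoc]
    rw [e]
    exact (Matrix.l2_opNorm_mul _ _).trans (mul_le_mul (opNorm_calG_one_sub_Pi_le N R M a ha hN hRN)
      (opNorm_adjoint_defect_fdiff_calG_le N R M a ha hN μ) (norm_nonneg _) hsm)
  calc _ ≤ _ := norm_add_le _ _
    _ ≤ 2 * d * Cst d a / N * (((R : ℝ) + 1) * Cst d a) + 2 * d * Cst d a / N * (((R : ℝ) + 1) * Cst d a) := add_le_add hA hB
    _ = 4 * d * ((R : ℝ) + 1) * Cst d a ^ 2 / N := by ring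

/-- `Δ′J − JΔ = Σ_μ (∇′_μᴴ∇′_μJ − J∇_μᴴ∇_μ)`. [folklore] -/
theorem Lap_comm_eq_sum :
    Lap (R * N) M * JK N R M - JK N R M * Lap N M
      = ∑ μ, ((gradF N R M μ)ᴴ * gradF N R M μ * JK N R M - JK N R M * ((gradC N M μ)ᴴ * gradC N M μ)) := by
  rw [Lap, Lap, Matrix.sum_mul, Matrix.mul_sum, ← Finset.sum_sub_distrib]

/-- **THE 𝒢-SANDWICHED KING LAW OF THE VECTOR LAPLACIAN, TWO LEVELS**: `‖𝒢^{(RN)}·(Δ′J_R − J_RΔ)·𝒢^{(N)}‖ ≤ 4d²(R+1)·Cst²/N`.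
[cite: Balaban1984PropagatorsI, Prop. 1.1 (1.89) p.33; King1986, (2.10) p.653, Lemma 4.5 (4.38) p.674 (shape)] [folklore] -/
theorem opNorm_calG_Lap_comm_calG_le (hd : 1 ≤ d) (hN : 1 ≤ N) (hRN : 1 ≤ R * N) :
    ‖calG (R * N) hRN M a ha * (Lap (R * N) M * JK N R M - JK N R M * Lap N M) * calG N hN M a ha‖
      ≤ 4 * d ^ 2 * ((R : ℝ) + 1) * Cst d a ^ 2 / N := by
  rw [Lap_comm_eq_sum, Matrix.mul_sum, Matrix.sum_mul]
  refine (norm_sum_le _ _).trans ?_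
  calc ∑ μ, ‖calG (R * N) hRN M a ha * ((gradF N R M μ)ᴴ * gradF N R M μ * JK N R M - JK N R M * ((gradC N M μ)ᴴ * gradC N M μ))
          * calG N hN M a ha‖
      ≤ ∑ _μ : Fin d, 4 * d * ((R : ℝ) + 1) * Cst d a ^ 2 / N :=
        Finset.sum_le_sum fun μ _ => opNorm_calG_lapDir_comm_calG_le N R M a ha hd hN hRN μ
    _ = 4 * d ^ 2 * ((R : ℝ) + 1) * Cst d a ^ 2 / N := by
        rw [Finset.sum_const, Finset.card_univ, Fintype.card_fin, nsmul_eq_mul]; ring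

end TwoLevel

/-! ## §4 Along the tower `n_k = L^k` -/

section Tower

variable (L : ℕ) [NeZero L] (M : Fin d → ℕ) [hM : ∀ μ, NeZero (M μ)] (a : ℝ) (ha : 0 < a)

/-- the constant of the Laplacian's sandwiched two-level law. [folklore] -/
def CLap (d L : ℕ) (a : ℝ) : ℝ := 4 * d ^ 2 * ((L : ℝ) + 1) * Cst d a ^ 2

omit [NeZero L] in
/-- `0 ≤ CLap`. [folklore] -/
theorem CLap_nonneg (d L : ℕ) (a : ℝ) : 0 ≤ CLap d L a := by unfold CLap; positivity

/-- **THE TOWER FORM**: `‖𝒢^{(k+1)}·(Δ_{k+1}J_k − J_kΔ_k)·𝒢^{(k)}‖ ≤ CLap·L^{−k}` — the vector-Laplacian piece of the graded well's leaf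
(GW-E) in the (H-cons) currency, a THEOREM. [cite: Balaban1984PropagatorsI, Prop. 1.1 (1.89) p.33; King1986, Lemma 4.5 (4.38) p.674 (shape)]
[folklore] -/
theorem lap_consistent_le_lev (hd : 1 ≤ d) (k : ℕ) :
    ‖(calDalev L M a ha (k + 1))⁻¹ * (Lap (lev L (k + 1)) M * JpcT L M k - JpcT L M k * Lap (lev L k) M) * (calDalev L M a ha k)⁻¹‖
      ≤ CLap d L a * ((L : ℝ)⁻¹) ^ k := by
  have hL1 : 1 ≤ L := Nat.pos_of_ne_zero (NeZero.ne L)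
  have h := opNorm_calG_Lap_comm_calG_le (lev L k) L M a ha hd (one_le_lev' L k) (one_le_lev' L (k + 1))
  rw [cast_lev'] at h
  rw [calDalev_inv, calDalev_inv, inv_pow, ← div_eq_mul_inv]
  exact h

/-- the same with `B5Action121.LapV` (the spelling of `GradedWellData.localGW_eq`; `Lap n M = LapV (fine n M) n` definitionally). [folklore] -/
theorem lapV_consistent_le_lev (hd : 1 ≤ d) (k : ℕ) :
    ‖(calDalev L M a ha (k + 1))⁻¹
        * (LapV (fine (lev L (k + 1)) M) ((lev L (k + 1) : ℕ) : ℂ) * JpcT L M k - JpcT L M k * LapV (fine (lev L k) M) ((lev L k : ℕ) : ℂ))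
        * (calDalev L M a ha k)⁻¹‖ ≤ CLap d L a * ((L : ℝ)⁻¹) ^ k :=
  lap_consistent_le_lev L M a ha hd k

end Tower

end Summit.QuantumFields.BalabanUV.T4Continuum.KingLaplacianConsistency

end
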